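import Literature.Probability.Percolation.AnchoredProfileAllOpen
import Literature.Probability.LatticeModels.LoomisWhitney
import HarnessLib

/-!
# The value of the all-open anchored isoperimetric profile: `n φ̂_n(E) → 2d`

Topic `Literature/Probability/Percolation`. Sequel of `AnchoredProfileAllOpen.lean` (the `p = 1`
case of the named fact `CerfDembin2020_thm11`, where `n φ̂_n(E) → c_d = isoConst d ≥ 2` was
proved by scale invariance). With the sharp edge-isoperimetric inequality
`2d |A|^{(d-1)/d} ≤ #(boundaryPairs A)` of `LoomisWhitney.lean` (discrete Loomis–Whitney + AM–GM)
the constant is identified: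

* `isoConst_eq_two_mul` — **`c_d = 2d`**: `≥` by the sharp inequality for every competitor, `≤`
  by the competitor `{0}` (`2d` boundary pairs, one site);
* `tendsto_mul_anchoredProfile_allOpen_two_mul`, `CerfDembin2020_thm11_one_two_mul` — hence
  **`n φ̂_n(E) → 2d`** and, `P_1`-a.s., `n φ̂_n → 2d`: the constant `φ(1) = 2d` of Theorem 1.1 at
  `p = 1`, in accordance with the Wulff value `I_1(W_1)` for the `ℓ¹`-surface tension
  `β_1(v) = ‖v‖₁` of the fully open lattice, whose Wulff crystal is the unit cube
  [Dembin2020, Thm. 1 (the limit is I_p(W_p))].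

Everything is proved; no definition and no named fact is introduced.
-/

noncomputable section

namespace Literature.Probability.Percolation

open Finset LatticeModels
open _root_.MeasureTheory _root_.Filter
open scoped _root_.Topology

variable {d : ℕ}

/-- Every competing ratio is at least `2d` (sharp edge-isoperimetric inequality).
[cite: LoomisWhitney1949, Theorem 2 (isoperimetric corollary)] -/
theorem two_mul_le_isoRatio (hd : 1 ≤ d) {H : Finset (Site d)} (hH : H.Nonempty) :
    2 * (d : ℝ) ≤ (#(boundaryPairs H) : ℝ) / (#H : ℝ) ^ (((d : ℝ) - 1) / d) := by
  have hpos : (0 : ℝ) < (#H : ℝ) ^ (((d : ℝ) - 1) / d) :=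
    Real.rpow_pos_of_pos (by exact_mod_cast hH.card_pos) _
  rw [le_div_iff₀ hpos]
  exact two_mul_card_mul_rpow_le_card_boundaryPairs hd H hH

/-- The singleton competitor has ratio exactly `2d`. [folklore] -/
theorem isoRatio_singleton (x : Site d) :
    (#(boundaryPairs ({x} : Finset (Site d))) : ℝ) /
      (#({x} : Finset (Site d)) : ℝ) ^ (((d : ℝ) - 1) / d) = 2 * d := by
  rw [card_boundaryPairs_singleton, card_singleton, Nat.cast_one, Real.one_rpow, div_one]
  push_cast
  ring

/-- **`c_d = 2d`**: the lattice isoperimetric constant of `AnchoredProfileAllOpen.lean` equals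
`2d` (`d ≥ 1`). [cite: LoomisWhitney1949, Theorem 2 (isoperimetric corollary)] -/
theorem isoConst_eq_two_mul (hd : 1 ≤ d) : isoConst d = 2 * d := by
  refine le_antisymm ?_ ?_
  · have h := isoConst_le hd (isValidSubgraph_singleton d (zdGraph d).edgeSet)
    rwa [isoRatio_singleton] at h
  · refine le_csInf (isoConst_set_nonempty d) ?_
    rintro r ⟨H, hH, rfl⟩
    exact two_mul_le_isoRatio hd ⟨0, hH.1⟩

/-- **`n φ̂_n(E) → 2d`**: with every edge open, the rescaled anchored isoperimetric profile of
`ℤ^d` converges to `2d` (`d ≥ 1`). [cite: CerfDembin2020, Thm 1.1 (case p = 1, value 2d)] -/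
theorem tendsto_mul_anchoredProfile_allOpen_two_mul (hd : 1 ≤ d) :
    Tendsto (fun n : ℕ => (n : ℝ) * anchoredProfile d n (zdGraph d).edgeSet) atTop
      (𝓝 (2 * (d : ℝ))) := by
  rw [← isoConst_eq_two_mul hd]
  exact tendsto_mul_anchoredProfile_allOpen hd

/-- `n φ̂_n(E) ≥ 2d` for EVERY `n ≥ 1` (not only in the limit). [folklore] -/
theorem two_mul_le_mul_anchoredProfile_allOpen (hd : 1 ≤ d) {n : ℕ} (hn : 1 ≤ n) :
    2 * (d : ℝ) ≤ n * anchoredProfile d n (zdGraph d).edgeSet := by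
  rw [← isoConst_eq_two_mul hd]
  exact isoConst_le_mul_anchoredProfile_allOpen hd hn

/-- **Cerf–Dembin 2020, Theorem 1.1 at `p = 1`, with its constant**: `P_1`-a.s., if `|C(0)| = ∞`
(indeed always, a.s. every edge being open) then `n φ̂_n → 2d` (`d ≥ 1`); so `φ(1) = 2d`.
[cite: CerfDembin2020, Thm 1.1 (case p = 1, value 2d)] -/
theorem CerfDembin2020_thm11_one_two_mul (hd : 1 ≤ d) :
    ∀ᵐ ω ∂(bondPercolation (zdGraph d) 1), (openCluster ω 0).Infinite →
      Tendsto (fun n : ℕ => (n : ℝ) * anchoredProfile d n ω) atTop (𝓝 (2 * (d : ℝ))) := by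
  rw [bondPercolation_one_eq_dirac, ae_dirac_eq]
  exact Filter.eventually_pure.2 fun _ => tendsto_mul_anchoredProfile_allOpen_two_mul hd

end Literature.Probability.Percolation

end
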